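import Summits.PneNP.PneNP.Theorems.SymmetryBudgetWindowCanoniserSoundB1

/-!
# Window canoniser, XXVI: soundness at section nodes, II — blocks, intervals and the pasted ordering

Route `PneNP/SymmetryBudget`, dichotomy `WindowBarrier` (stmt-PneNP-2145) / `NoHiddenOrder` (stmt-PneNP-14781);
continuation of `…WindowCanoniserSoundB1.lean`.  In the context of a section node: the parts `WCan.SecCtx.P`, the
injective key `ckey K = (vecK K, min K)`, the interval `[cstart K, cstart K + |K|)` of a part and the block
`[bstart V, bstart V + bsize V)` of a part vector; the intervals partition `[0, |U|)` (`Kp p`: the part of position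
`p`), the interval of a part lies in the block of its vector at a multiple of `|K|` (`WCan.SecCtx.dvd_cstart_sub`),
and **the pasted ordering** `WCan.SecCtx.ORD p = ordK (Kp p) (p - cstart (Kp p))` is a valid ordering of `U`
(`WCan.SecCtx.validOrd_ORD`).
-/

-- `Summit.PneNP.PneNP.…` duplicates `PneNP` BY DESIGN (single-problem summit, D-0017 layout).
set_option linter.dupNamespace false

noncomputable section

namespace Summit.PneNP.PneNP.Theorems

namespace WCan

open Finset Literature.Computability.Complexity Literature.Computability.Complexity.CGCanon
  Literature.Combinatorics.SimpleGraph
open scoped Classical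

variable {K r n : ℕ} [NeZero n]

namespace SecCtx

variable {L : Lab K n} {x : Fin (r + n) × Fin (r + n) → Bool} {ordK : Finset (Fin n) → ℕ → Fin n} (C : SecCtx L x ordK)

/-! ### The parts -/

/-- The set of parts. -/
def P (L : Lab K n) (x : Fin (r + n) × Fin (r + n) → Bool) : Finset (Finset (Fin n)) := L.1.U.image (Kf L x)

/-- The least element of a part (as a number; `0` for the empty set). -/
def mn (K' : Finset (Fin n)) : ℕ := if h : K'.Nonempty then (K'.min' h : ℕ) else 0

/-- The KEY of a part: its vector, then its least element. -/
def ckey (K' : Finset (Fin n)) : Lex (Lex (Fin (NBp r n) → Bool) × ℕ) :=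
  toLex (toLex (vecK (L := L) (x := x) (ordK := ordK) K'), mn K')

/-- The START of the interval of a part: vertices of `U` whose part has a smaller key. -/
def cstart (K' : Finset (Fin n)) : ℕ := (L.1.U.filter fun w => ckey (L := L) (x := x) (ordK := ordK) (Kf L x w) < ckey (L := L) (x := x) (ordK := ordK) K').card

/-- The START of the block of a vector. -/
def bstart (V : Lex (Fin (NBp r n) → Bool)) : ℕ := (L.1.U.filter fun w => toLex (vecK (L := L) (x := x) (ordK := ordK) (Kf L x w)) < V).card

/-- The SIZE of the block of a vector. -/
def bsize (V : Lex (Fin (NBp r n) → Bool)) : ℕ := (L.1.U.filter fun w => toLex (vecK (L := L) (x := x) (ordK := ordK) (Kf L x w)) = V).card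

include C

omit [NeZero n] C in
/-- Membership in the set of parts. -/
theorem mem_P {K' : Finset (Fin n)} : K' ∈ P L x ↔ ∃ u ∈ L.1.U, Kf L x u = K' := by simp [P]

/-- Parts lie in `U`, are nonempty, and are the parts of their members. -/
theorem P_spec {K' : Finset (Fin n)} (hK : K' ∈ P L x) : K' ⊆ L.1.U ∧ K'.Nonempty ∧ ∀ v ∈ K', Kf L x v = K' := by
  obtain ⟨u, hu, rfl⟩ := mem_P.1 hK
  exact ⟨C.Kf_subset u, ⟨u, C.mem_Kf_self hu⟩, fun v hv => Kf_eq_of_mem hv⟩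

omit [NeZero n] C in
/-- The part of a member of `U` is a part. -/
theorem Kf_mem_P {u : Fin n} (hu : u ∈ L.1.U) : Kf L x u ∈ P L x := mem_P.2 ⟨u, hu, rfl⟩

/-- Members of a part, as a fibre. -/
theorem mem_iff_Kf_eq {K' : Finset (Fin n)} (hK : K' ∈ P L x) {w : Fin n} : w ∈ K' ↔ w ∈ L.1.U ∧ Kf L x w = K' := by
  obtain ⟨hKU, -, hKf⟩ := C.P_spec hK
  exact ⟨fun hw => ⟨hKU hw, hKf w hw⟩, fun ⟨hw, he⟩ => he ▸ C.mem_Kf_self hw⟩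

omit [NeZero n] C in
/-- Parts have at most `n` elements. -/
theorem card_le_n (K' : Finset (Fin n)) : K'.card ≤ n := (card_le_univ _).trans_eq (by simp)

/-- **The least element is injective on parts.** -/
theorem eq_of_mn_eq {K₁ K₂ : Finset (Fin n)} (h1 : K₁ ∈ P L x) (h2 : K₂ ∈ P L x) (h : mn K₁ = mn K₂) : K₁ = K₂ := by
  obtain ⟨-, hne1, hKf1⟩ := C.P_spec h1
  obtain ⟨-, hne2, hKf2⟩ := C.P_spec h2
  simp only [mn, hne1, hne2, ↓reduceDIte] at h
  have hm : K₁.min' hne1 = K₂.min' hne2 := Fin.ext h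
  rw [← hKf1 _ (min'_mem K₁ hne1), ← hKf2 _ (min'_mem K₂ hne2), hm]

/-- Hence so is the key. -/
theorem eq_of_ckey_eq {K₁ K₂ : Finset (Fin n)} (h1 : K₁ ∈ P L x) (h2 : K₂ ∈ P L x)
    (h : ckey (L := L) (x := x) (ordK := ordK) K₁ = ckey (L := L) (x := x) (ordK := ordK) K₂) : K₁ = K₂ := by
  simp only [ckey, toLex_inj, Prod.mk.injEq] at h
  exact C.eq_of_mn_eq h1 h2 h.2

/-- **Counting by parts**: the members of `U` whose part satisfies `Q` are counted part by part. -/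
theorem card_filter_eq_sum (Q : Finset (Fin n) → Prop) [DecidablePred Q] :
    (L.1.U.filter fun w => Q (Kf L x w)).card = ∑ K' ∈ (P L x).filter Q, K'.card := by
  rw [card_eq_sum_card_fiberwise (f := Kf L x) (t := (P L x).filter Q)]
  · refine sum_congr rfl fun K' hK' => ?_
    obtain ⟨hK', hQ⟩ := mem_filter.1 hK'
    congr 1; ext w
    simp only [mem_filter, C.mem_iff_Kf_eq hK']
    constructor
    · rintro ⟨⟨hw, -⟩, he⟩; exact ⟨hw, he⟩
    · rintro ⟨hw, he⟩; exact ⟨⟨hw, he.symm ▸ hQ⟩, he⟩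
  · intro w hw
    have hw' := mem_filter.1 (Finset.mem_coe.1 hw)
    exact Finset.mem_coe.2 (mem_filter.2 ⟨Kf_mem_P hw'.1, hw'.2⟩)

/-! ### Equal vectors -/

omit [NeZero n] C in
/-- Parts with the same vector have the same size. -/
theorem card_eq_of_vecK_eq {K₁ K₂ : Finset (Fin n)}
    (h : vecK (L := L) (x := x) (ordK := ordK) K₁ = vecK (L := L) (x := x) (ordK := ordK) K₂) : K₁.card = K₂.card := by
  have := congr_fun h (bpSize ⟨K₁.card, Nat.lt_succ_of_le (card_le_n K₁)⟩)
  simp only [vecK, PV, bpdec_bpSize] at this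
  rw [decide_eq_decide] at this
  exact (this.1 trivial).symm

omit [NeZero n] C in
/-- Parts with the same vector have the same data at every position. -/
theorem PV_iff_of_vecK_eq {K₁ K₂ : Finset (Fin n)}
    (h : vecK (L := L) (x := x) (ordK := ordK) K₁ = vecK (L := L) (x := x) (ordK := ordK) K₂) (b : BIdx r n) :
    PV (L := L) (x := x) (ordK := ordK) K₁ (bpVal (benc b)) ↔ PV (L := L) (x := x) (ordK := ordK) K₂ (bpVal (benc b)) := by
  have := congr_fun h (bpVal (benc b))
  simp only [vecK] at this
  rwa [decide_eq_decide] at this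

/-! ### Intervals -/

/-- The end of the interval of a part counts the keys up to its key. -/
theorem cstart_add_card {K' : Finset (Fin n)} (hK : K' ∈ P L x) :
    cstart (L := L) (x := x) (ordK := ordK) K' + K'.card =
      (L.1.U.filter fun w => ckey (L := L) (x := x) (ordK := ordK) (Kf L x w) ≤ ckey (L := L) (x := x) (ordK := ordK) K').card := by
  rw [cstart, ← card_union_of_disjoint]
  · congr 1; ext w; simp only [mem_union, mem_filter, C.mem_iff_Kf_eq hK]; constructor
    · rintro (⟨hw, h⟩ | ⟨hw, h⟩); exacts [⟨hw, le_of_lt h⟩, ⟨hw, by rw [h]⟩]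
    · rintro ⟨hw, h⟩
      rcases lt_or_eq_of_le h with h | h
      exacts [Or.inl ⟨hw, h⟩, Or.inr ⟨hw, C.eq_of_ckey_eq (Kf_mem_P hw) hK h⟩]
  · exact disjoint_left.2 fun w h1 h2 => ne_of_lt (mem_filter.1 h1).2 (by rw [((C.mem_iff_Kf_eq hK).1 h2).2])

/-- Intervals end inside `[0, |U|]`. -/
theorem cstart_add_card_le {K' : Finset (Fin n)} (hK : K' ∈ P L x) : cstart (L := L) (x := x) (ordK := ordK) K' + K'.card ≤ L.1.U.card := by
  rw [C.cstart_add_card hK]; exact card_filter_le _ _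

/-- **Intervals of parts with smaller keys end before intervals of parts with larger keys start.** -/
theorem cstart_add_card_le_cstart {K₁ K₂ : Finset (Fin n)} (h1 : K₁ ∈ P L x)
    (h : ckey (L := L) (x := x) (ordK := ordK) K₁ < ckey (L := L) (x := x) (ordK := ordK) K₂) :
    cstart (L := L) (x := x) (ordK := ordK) K₁ + K₁.card ≤ cstart (L := L) (x := x) (ordK := ordK) K₂ := by
  rw [C.cstart_add_card h1, cstart]
  exact card_le_card fun w hw => mem_filter.2 ⟨(mem_filter.1 hw).1, (mem_filter.1 hw).2.trans_lt h⟩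

/-- **Every position below `|U|` lies in the interval of some part.** -/
theorem exists_interval {p : ℕ} (hp : p < L.1.U.card) :
    ∃ K' ∈ P L x, cstart (L := L) (x := x) (ordK := ordK) K' ≤ p ∧ p < cstart (L := L) (x := x) (ordK := ordK) K' + K'.card := by
  have hUne : L.1.U.Nonempty := card_pos.1 (by omega)
  have hPne : (P L x).Nonempty := by obtain ⟨u, hu⟩ := hUne; exact ⟨_, Kf_mem_P hu⟩
  -- the part with the least key starts at `0`
  obtain ⟨K₀, hK₀, hmin⟩ := exists_min_image (P L x) (ckey (L := L) (x := x) (ordK := ordK)) hPne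
  have h0 : cstart (L := L) (x := x) (ordK := ordK) K₀ = 0 := by
    rw [cstart, card_eq_zero, filter_eq_empty_iff]
    intro w hw; exact not_lt.2 (hmin _ (Kf_mem_P hw))
  -- the part with the largest key among those starting at or before `p`
  set A := (P L x).filter fun K' => cstart (L := L) (x := x) (ordK := ordK) K' ≤ p with hA
  have hAne : A.Nonempty := ⟨K₀, mem_filter.2 ⟨hK₀, by omega⟩⟩
  obtain ⟨K', hK'A, hmax⟩ := exists_max_image A (ckey (L := L) (x := x) (ordK := ordK)) hAne
  obtain ⟨hK', hle⟩ := mem_filter.1 hK'A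
  refine ⟨K', hK', hle, ?_⟩
  by_contra hge
  rw [not_lt, C.cstart_add_card hK'] at hge
  -- some vertex has a larger key; the least such key starts a part of `A` with a larger key
  set B := L.1.U.filter fun w => ckey (L := L) (x := x) (ordK := ordK) K' < ckey (L := L) (x := x) (ordK := ordK) (Kf L x w) with hB
  have hsplit : (L.1.U.filter fun w => ckey (L := L) (x := x) (ordK := ordK) (Kf L x w) ≤ ckey (L := L) (x := x) (ordK := ordK) K').card + B.card =
      L.1.U.card := by
    rw [hB, ← card_union_of_disjoint]
    · congr 1; ext w; simp only [mem_union, mem_filter]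
      constructor
      · rintro (⟨hw, -⟩ | ⟨hw, -⟩) <;> exact hw
      · intro hw; rcases le_or_gt (ckey (L := L) (x := x) (ordK := ordK) (Kf L x w)) (ckey (L := L) (x := x) (ordK := ordK) K') with h | h
        exacts [Or.inl ⟨hw, h⟩, Or.inr ⟨hw, h⟩]
    · exact disjoint_left.2 fun w ha hb => absurd (mem_filter.1 hb).2 (not_lt.2 (mem_filter.1 ha).2)
  have hBne : B.Nonempty := card_pos.1 (by omega)
  obtain ⟨w₁, hw₁, hw₁min⟩ := exists_min_image B (fun w => ckey (L := L) (x := x) (ordK := ordK) (Kf L x w)) hBne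
  obtain ⟨hw₁U, hw₁gt⟩ := mem_filter.1 hw₁
  have hcs : cstart (L := L) (x := x) (ordK := ordK) (Kf L x w₁) =
      (L.1.U.filter fun w => ckey (L := L) (x := x) (ordK := ordK) (Kf L x w) ≤ ckey (L := L) (x := x) (ordK := ordK) K').card := by
    rw [cstart]; congr 1; ext w; simp only [mem_filter]
    constructor
    · rintro ⟨hw, hlt⟩
      refine ⟨hw, ?_⟩
      by_contra hgt; rw [not_le] at hgt
      exact absurd (hw₁min w (mem_filter.2 ⟨hw, hgt⟩)) (not_le.2 hlt)
    · rintro ⟨hw, hle'⟩; exact ⟨hw, hle'.trans_lt hw₁gt⟩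
  have hmemA : Kf L x w₁ ∈ A := mem_filter.2 ⟨Kf_mem_P hw₁U, by rw [hcs]; exact hge⟩
  exact absurd (hmax _ hmemA) (not_le.2 hw₁gt)

/-- **The part of position `p`.** -/
def Kp (p : ℕ) : Finset (Fin n) :=
  if h : ∃ K' ∈ P L x, cstart (L := L) (x := x) (ordK := ordK) K' ≤ p ∧ p < cstart (L := L) (x := x) (ordK := ordK) K' + K'.card
  then Classical.choose h else ∅

/-- Its interval contains `p`. -/
theorem Kp_spec {p : ℕ} (hp : p < L.1.U.card) :
    Kp (L := L) (x := x) (ordK := ordK) p ∈ P L x ∧ cstart (L := L) (x := x) (ordK := ordK) (Kp (L := L) (x := x) (ordK := ordK) p) ≤ p ∧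
      p < cstart (L := L) (x := x) (ordK := ordK) (Kp (L := L) (x := x) (ordK := ordK) p) + (Kp (L := L) (x := x) (ordK := ordK) p).card := by
  have h := C.exists_interval hp
  have h' : ∃ K', K' ∈ P L x ∧ cstart (L := L) (x := x) (ordK := ordK) K' ≤ p ∧ p < cstart (L := L) (x := x) (ordK := ordK) K' + K'.card := by
    obtain ⟨K', hK', h1, h2⟩ := h; exact ⟨K', hK', h1, h2⟩
  unfold Kp
  rw [dif_pos h']
  exact Classical.choose_spec h'

/-- **Uniqueness**: a part whose interval contains `p` is the part of `p`. -/
theorem Kp_eq {p : ℕ} {K' : Finset (Fin n)} (hK : K' ∈ P L x) (h1 : cstart (L := L) (x := x) (ordK := ordK) K' ≤ p)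
    (h2 : p < cstart (L := L) (x := x) (ordK := ordK) K' + K'.card) : Kp (L := L) (x := x) (ordK := ordK) p = K' := by
  have hp : p < L.1.U.card := h2.trans_le (C.cstart_add_card_le hK)
  obtain ⟨hKp, h1', h2'⟩ := C.Kp_spec hp
  by_contra hne
  rcases lt_trichotomy (ckey (L := L) (x := x) (ordK := ordK) (Kp (L := L) (x := x) (ordK := ordK) p)) (ckey (L := L) (x := x) (ordK := ordK) K')
    with h | h | h
  · have := C.cstart_add_card_le_cstart hKp h; omega
  · exact hne (C.eq_of_ckey_eq hKp hK h)
  · have := C.cstart_add_card_le_cstart hK h; omega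

/-- Positions of the interval of a part belong to it. -/
theorem Kp_cstart_add {K' : Finset (Fin n)} (hK : K' ∈ P L x) {o : ℕ} (ho : o < K'.card) :
    Kp (L := L) (x := x) (ordK := ordK) (cstart (L := L) (x := x) (ordK := ordK) K' + o) = K' :=
  C.Kp_eq hK (by omega) (by omega)

/-! ### Intervals inside blocks -/

omit [NeZero n] C in
/-- The interval of a part starts inside the block of its vector … -/
theorem bstart_le_cstart (K' : Finset (Fin n)) :
    bstart (L := L) (x := x) (ordK := ordK) (toLex (vecK (L := L) (x := x) (ordK := ordK) K')) ≤ cstart (L := L) (x := x) (ordK := ordK) K' := by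
  unfold bstart cstart
  refine card_le_card fun w hw => mem_filter.2 ⟨(mem_filter.1 hw).1, ?_⟩
  exact Prod.Lex.toLex_lt_toLex.2 (Or.inl (mem_filter.1 hw).2)

/-- … and ends inside it. -/
theorem cstart_add_card_le_block {K' : Finset (Fin n)} (hK : K' ∈ P L x) :
    cstart (L := L) (x := x) (ordK := ordK) K' + K'.card ≤
      bstart (L := L) (x := x) (ordK := ordK) (toLex (vecK (L := L) (x := x) (ordK := ordK) K')) +
        bsize (L := L) (x := x) (ordK := ordK) (toLex (vecK (L := L) (x := x) (ordK := ordK) K')) := by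
  rw [C.cstart_add_card hK, bstart, bsize, ← card_union_of_disjoint]
  · refine card_le_card fun w hw => ?_
    obtain ⟨hwU, hle⟩ := mem_filter.1 hw
    rw [mem_union, mem_filter, mem_filter]
    rcases Prod.Lex.toLex_le_toLex.1 hle with h | ⟨h, -⟩
    · exact Or.inl ⟨hwU, h⟩
    · exact Or.inr ⟨hwU, h⟩
  · exact disjoint_left.2 fun w h1 h2 => (mem_filter.1 h1).2.ne (mem_filter.1 h2).2

omit [NeZero n] C in
/-- Blocks end inside `[0, |U|]`. -/
theorem bstart_add_bsize_le (V : Lex (Fin (NBp r n) → Bool)) :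
    bstart (L := L) (x := x) (ordK := ordK) V + bsize (L := L) (x := x) (ordK := ordK) V ≤ L.1.U.card := by
  rw [bstart, bsize, ← card_union_of_disjoint]
  · exact card_le_card (union_subset (filter_subset _ _) (filter_subset _ _))
  · exact disjoint_left.2 fun w h1 h2 => (mem_filter.1 h1).2.ne (mem_filter.1 h2).2

/-- **Inside its block, the interval of a part starts at a multiple of the part size.** -/
theorem dvd_cstart_sub (K' : Finset (Fin n)) :
    K'.card ∣ cstart (L := L) (x := x) (ordK := ordK) K' - bstart (L := L) (x := x) (ordK := ordK) (toLex (vecK (L := L) (x := x) (ordK := ordK) K')) := by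
  have hsplit : cstart (L := L) (x := x) (ordK := ordK) K' =
      bstart (L := L) (x := x) (ordK := ordK) (toLex (vecK (L := L) (x := x) (ordK := ordK) K')) +
        (L.1.U.filter fun w => vecK (L := L) (x := x) (ordK := ordK) (Kf L x w) = vecK (L := L) (x := x) (ordK := ordK) K' ∧
          mn (Kf L x w) < mn K').card := by
    rw [cstart, bstart, ← card_union_of_disjoint]
    · congr 1; ext w
      simp only [mem_filter, mem_union, ckey, Prod.Lex.toLex_lt_toLex, toLex_inj]
      tauto
    · exact disjoint_left.2 fun w h1 h2 => (mem_filter.1 h1).2.ne (toLex_inj.2 (mem_filter.1 h2).2.1)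
  rw [hsplit, Nat.add_sub_cancel_left]
  have hsum : (L.1.U.filter fun w => vecK (L := L) (x := x) (ordK := ordK) (Kf L x w) = vecK (L := L) (x := x) (ordK := ordK) K' ∧
      mn (Kf L x w) < mn K').card = ∑ K'' ∈ (P L x).filter (fun K'' => vecK (L := L) (x := x) (ordK := ordK) K'' =
        vecK (L := L) (x := x) (ordK := ordK) K' ∧ mn K'' < mn K'), K''.card :=
    C.card_filter_eq_sum (fun K'' => vecK (L := L) (x := x) (ordK := ordK) K'' = vecK (L := L) (x := x) (ordK := ordK) K' ∧ mn K'' < mn K')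
  rw [hsum]
  exact dvd_sum fun K'' hK'' => by rw [card_eq_of_vecK_eq (mem_filter.1 hK'').2.1]

/-! ### The pasted ordering -/

/-- **The pasted ordering**: position `p` ↦ the vertex at offset `p - cstart (Kp p)` of the part of `p`. -/
def ORD (p : ℕ) : Fin n :=
  ordK (Kp (L := L) (x := x) (ordK := ordK) p) (p - cstart (L := L) (x := x) (ordK := ordK) (Kp (L := L) (x := x) (ordK := ordK) p))

/-- The part orderings are valid. -/
theorem validOrd_of_mem_P {K' : Finset (Fin n)} (hK : K' ∈ P L x) : ValidOrd K' (ordK K') := by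
  obtain ⟨u, hu, rfl⟩ := mem_P.1 hK
  obtain ⟨-, -, -, -, hvalid, -⟩ := C.part u hu
  exact hvalid

/-- The pasted ordering at a position of the interval of a part. -/
theorem ORD_cstart_add {K' : Finset (Fin n)} (hK : K' ∈ P L x) {o : ℕ} (ho : o < K'.card) :
    ORD (L := L) (x := x) (ordK := ordK) (cstart (L := L) (x := x) (ordK := ordK) K' + o) = ordK K' o := by
  rw [ORD, C.Kp_cstart_add hK ho, Nat.add_sub_cancel_left]

/-- The pasted ordering lands in the part of the position. -/
theorem ORD_mem {p : ℕ} (hp : p < L.1.U.card) : ORD (L := L) (x := x) (ordK := ordK) p ∈ Kp (L := L) (x := x) (ordK := ordK) p := by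
  obtain ⟨hKp, h1, h2⟩ := C.Kp_spec hp
  exact (C.validOrd_of_mem_P hKp).1 _ (by omega)

/-- Hence the part of `ORD p` is the part of `p`. -/
theorem Kf_ORD {p : ℕ} (hp : p < L.1.U.card) : Kf L x (ORD (L := L) (x := x) (ordK := ordK) p) = Kp (L := L) (x := x) (ordK := ordK) p :=
  (C.P_spec (C.Kp_spec hp).1).2.2 _ (C.ORD_mem hp)

/-- **The pasted ordering is a valid ordering of `U`.** -/
theorem validOrd_ORD : ValidOrd L.1.U (ORD (L := L) (x := x) (ordK := ordK)) := by
  refine ⟨fun p hp => (C.P_spec (C.Kp_spec hp).1).1 (C.ORD_mem hp), fun p q hp hq he => ?_, fun w hw => ?_⟩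
  · obtain ⟨hKp, hp1, hp2⟩ := C.Kp_spec hp
    obtain ⟨hKq, hq1, hq2⟩ := C.Kp_spec hq
    have hK : Kp (L := L) (x := x) (ordK := ordK) p = Kp (L := L) (x := x) (ordK := ordK) q := by
      rw [← C.Kf_ORD hp, ← C.Kf_ORD hq, he]
    unfold ORD at he
    rw [hK] at he hp1 hp2
    have := (C.validOrd_of_mem_P hKq).2.1 _ _ (by omega) (by omega) he
    omega
  · have hK : Kf L x w ∈ P L x := Kf_mem_P hw
    obtain ⟨o, ho, hw'⟩ := (C.validOrd_of_mem_P hK).2.2 w (C.mem_Kf_self hw)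
    exact ⟨cstart (L := L) (x := x) (ordK := ordK) (Kf L x w) + o, by have := C.cstart_add_card_le hK; omega,
      by rw [C.ORD_cstart_add hK ho, hw']⟩

end SecCtx

end WCan

end Summit.PneNP.PneNP.Theorems

end
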